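import Literature.AlgebraicGeometry.Motives.SeesawRelativeChartKernelRepr
import Literature.AlgebraicGeometry.Motives.SeesawRelativeChartCover
import HarnessLib

/-!
# THE RELATIVE SEESAW CLOSED SUBSCHEME over an affine Noetherian base — unconditional for proper flat families
# (Mumford, *Abelian Varieties* §10 p. 89 over a ring base; Görtz–Wedhorn II, Thm. 24.66)

Cell `hodgecm-mathlib`, F-DAG hand (h8) «relative seesaw for `A ×_S A → A`», file E12 = THE HEAD THE (h8-E) ENGINE PORT BUYS
(author B-p08 (g12); sockets posted 2026-08-30T05:02:07Z; port map `B-provers/B-p08/g11/PORTMAP-h8-RelativeSeesaw.B-p08g11.md`).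
g11՚s ★ top-layer head `SeesawRelative.exists_seesawSubscheme_of_repr` (`Motives/SeesawRelativeChartCover`) proves the relative
scheme-theoretic seesaw MODULO the engine seam `hX : ∀ U, H0Repr X 𝓕 U ∧ DualRepr X 𝓕 U h𝓕` (the relative Grothendieck complex of
the chart represents `B ↦ H⁰(X_B, 𝓕_B)` and its dual); the E11 engine head `SeesawRelative.h0KernelRepr_holds` /
`dualKernelRepr_holds` (`Motives/SeesawRelativeChartKernelRepr`, the `[Field K] ↦ [CommRing R]` port of the ★ product-family
Grothendieck-complex cone) discharges it for `X → Spec R` proper, geometrically integral, flat and universally open and `W` locally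
noetherian.  Hence:

* `SeesawRelative.h0Repr_and_dualRepr` — `hX` holds on every affine open `U ⊆ W`;
* **`SeesawRelative.exists_seesawSubscheme`** — for `R` noetherian, `X → Spec R` proper geometrically integral flat universally open and
  universally Stein (`UnivStein X`: `Γ(V, 𝒪_T) ⥲ Γ(X ×_R V, 𝒪)`, ★-discharged for abelian schemes by
  `AbelianSchemeOver.baseChange_app_bijective`), `W → Spec R` locally of finite type and `𝓕` quasi-coherent of rank one on `X ×_R W`,
  there is a closed subscheme `Z ↪ W` such that ANY `u : S → W` over `R` factors through `Z` iff `(1 × u)^*𝓕 ≅ pr_S^*𝓜` for an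
  invertible quasi-coherent `𝓜` on `S` — the ★ R10 conclusion BYTE-IDENTICAL with `hX` gone;
* `SeesawRelative.exists_seesawSubscheme'` — the same in rank-one currency (no quasi-coherence binders).

HYPOTHESIS LEDGER against the ★ absolute `SeesawSubscheme.exists_seesawSubscheme'` (base `ℂ`): `[Field ℂ] ↦ [CommRing R] [IsNoetherianRing R]`;
`flat_hom_of_field ↦ [Flat X.hom]`; `universallyOpen_hom_of_isProper ↦ [UniversallyOpen X.hom]`; Stein `snd_app_bijective_holds ↦ hSt`;
`isNoetherianRing_chart ↦ IsLocallyNoetherian W.left` (from `[IsNoetherianRing R] [LocallyOfFiniteType W.hom]` by Mathlib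
`LocallyOfFiniteType.isLocallyNoetherian`).  No (h2) head is consumed (product families only).  Consumers: (h5-C) road (C1) «`K(L) ↪ A`
closed subgroup scheme» at `X := A_R, W := A_R, 𝓕 := mumfordBundle L` (★ `AbelianSchemes/AbelianSchemeKOfL`), F-3 (Q4).
Everything is proved; no named facts, no `sorry`.  HC_CM is proved only modulo the 7 printed citations until rung 0 closes; this file
asserts nothing about HC.

## References
* [MumfordAV1970] D. Mumford, *Abelian Varieties*, TIFR Studies in Mathematics 5 (1970), §5 Theorem and Cor. 2 (pp. 46–50), §10 (p. 89).
* [GortzWedhorn2023] U. Görtz, T. Wedhorn, *Algebraic Geometry II: Cohomology of Schemes* (2023), Thm. 24.66 (p. 405; proof pp. 407–408),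
  Cor. 23.135 (p. 355).
-/

set_option autoImplicit false

noncomputable section

-- `TopCat.Presheaf`/`Scheme.Modules` are not reducible (as in Mathlib's `AlgebraicGeometry/Modules`).
set_option backward.isDefEq.respectTransparency false

open CategoryTheory CategoryTheory.Limits AlgebraicGeometry MonoidalCategory CartesianMonoidalCategory
  Opposite

namespace Literature.AlgebraicGeometry.Motives

namespace SeesawRelative

open Literature.AlgebraicGeometry.Modules

/-- **The engine seam `hX` of ★ `exists_seesawSubscheme_of_repr` DISCHARGED**: on every affine open `U ⊆ W` the chart functors
`B ↦ H⁰(X_B, 𝓕_B)` and `B ↦ Hom(𝓕_B, 𝒪)` are represented by finitely generated `Γ(W, U)`-modules, naturally in `B`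
(E11 `h0KernelRepr_holds` / `dualKernelRepr_holds` through g11՚s ★ `h0Repr_of_kernelRepr` / `dualRepr_of_kernelRepr`).
[cite: MumfordAV1970, §5 Theorem (p. 46)] [cite: GortzWedhorn2023, Cor. 23.135 (p. 355)] -/
theorem h0Repr_and_dualRepr {R : Type} [CommRing R] (X : SchemeOver R) [IsProper X.hom] [GeometricallyIntegral X.hom]
    [Flat X.hom] [UniversallyOpen X.hom] {W : SchemeOver R} [IsLocallyNoetherian W.left] (𝓕 : (X ⊗ W).left.Modules)
    (h𝓕 : HasRank 𝓕 1) (U : W.left.affineOpens) :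
    SeesawRelative.H0Repr X 𝓕 U ∧ SeesawRelative.DualRepr X 𝓕 U h𝓕 :=
  ⟨h0Repr_of_kernelRepr X 𝓕 U (h0KernelRepr_holds X 𝓕 U h𝓕),
    dualRepr_of_kernelRepr X 𝓕 U h𝓕 (dualKernelRepr_holds X 𝓕 U h𝓕)⟩

/-- **THE RELATIVE SEESAW CLOSED SUBSCHEME, UNCONDITIONAL for proper flat families over an affine Noetherian base** ([MumfordAV1970]
§10 p. 89 read over a ring base; [GortzWedhorn2023] Thm. 24.66): for `R` noetherian, `X → Spec R` proper, geometrically integral, flat,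
universally open and universally Stein, `W → Spec R` locally of finite type and `𝓕` quasi-coherent of rank one on `X ×_R W`, there is
a closed subscheme `Z ↪ W` such that ANY `u : S → W` over `R` factors through `Z` iff `(1 × u)^*𝓕 ≅ pr_S^*𝓜` for an invertible
quasi-coherent `𝓜` on `S` (g11՚s ★ `exists_seesawSubscheme_of_repr` with its engine input `hX` discharged by `h0Repr_and_dualRepr`).
[cite: MumfordAV1970, §10 (p. 89)] [cite: GortzWedhorn2023, Thm. 24.66 (p. 405; proof pp. 407–408)] -/
theorem exists_seesawSubscheme {R : Type} [CommRing R] [IsNoetherianRing R] (X : SchemeOver R) [IsProper X.hom]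
    [GeometricallyIntegral X.hom] [Flat X.hom] [UniversallyOpen X.hom] (hSt : SeesawRelative.UnivStein X)
    (W : SchemeOver R) [LocallyOfFiniteType W.hom] (𝓕 : (X ⊗ W).left.Modules) [𝓕.IsQuasicoherent] (h𝓕 : HasRank 𝓕 1) :
    ∃ (Z : SchemeOver R) (i : Z ⟶ W) (_ : IsClosedImmersion i.left),
      ∀ (S : SchemeOver R) (u : S ⟶ W),
        (∃ v : S ⟶ Z, v ≫ i = u) ↔
          ∃ (𝓜 : S.left.Modules) (_ : 𝓜.IsQuasicoherent) (_ : HasRank 𝓜 1),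
            Nonempty ((Scheme.Modules.pullback (X ◁ u).left).obj 𝓕 ≅
              (Scheme.Modules.pullback (CartesianMonoidalCategory.snd X S).left).obj 𝓜) := by
  haveI : IsLocallyNoetherian W.left := LocallyOfFiniteType.isLocallyNoetherian W.hom
  exact exists_seesawSubscheme_of_repr X hSt W 𝓕 h𝓕 (fun U => h0Repr_and_dualRepr X 𝓕 h𝓕 U)

/-- The same in rank-one currency (no quasi-coherence binders: a module of constant rank is quasi-coherent, ★
`isQuasicoherent_of_hasRank`) — the unconditional relative twin of ★ `SeesawSubscheme.exists_seesawSubscheme'`.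
[cite: MumfordAV1970, §10 (p. 89)] [cite: GortzWedhorn2023, Thm. 24.66 (p. 405; proof pp. 407–408)] -/
theorem exists_seesawSubscheme' {R : Type} [CommRing R] [IsNoetherianRing R] (X : SchemeOver R) [IsProper X.hom]
    [GeometricallyIntegral X.hom] [Flat X.hom] [UniversallyOpen X.hom] (hSt : SeesawRelative.UnivStein X)
    (W : SchemeOver R) [LocallyOfFiniteType W.hom] (𝓕 : (X ⊗ W).left.Modules) (h𝓕 : HasRank 𝓕 1) :
    ∃ (Z : SchemeOver R) (i : Z ⟶ W) (_ : IsClosedImmersion i.left),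
      ∀ (S : SchemeOver R) (u : S ⟶ W),
        (∃ v : S ⟶ Z, v ≫ i = u) ↔
          ∃ (𝓜 : S.left.Modules) (_ : HasRank 𝓜 1),
            Nonempty ((Scheme.Modules.pullback (X ◁ u).left).obj 𝓕 ≅
              (Scheme.Modules.pullback (CartesianMonoidalCategory.snd X S).left).obj 𝓜) := by
  haveI : IsLocallyNoetherian W.left := LocallyOfFiniteType.isLocallyNoetherian W.hom
  exact exists_seesawSubscheme_of_repr' X hSt W 𝓕 h𝓕 (fun U => h0Repr_and_dualRepr X 𝓕 h𝓕 U)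

end SeesawRelative

end Literature.AlgebraicGeometry.Motives

end
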